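import Summits.ResolutionOfSingularities.ResolutionOfSingularities.Theorems.EquisingularLiftEquisingularLiftNatCentreTwoFrame
import HarnessLib

/-!
# [OURS · L1 W4.5(b) · EL♮(3)] T-DIM-CENTRE, converse — the codimension clause FROM quasi-regular 2-frames
# (`hcodim` of T-CENTRE-2FRAME (ii) `isRegularImmersionOfCodim_two_of_twoFrames` at a ROOT, where `DirLift.Ruled` (R3) holds the frames)
# (crux `EquisingularLiftNatThree` stmt-ResolutionOfSingularities-20148 / parent EL♮ stmt-…-20038; route C `hri`, S6)

NOT a statement of any manuscript. Helper file of the chain res-L1-w45b (cell `res-hironaka`, slot W4.5(b)); OURS; AI-written, weaker than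
expert review; `--supports stmt-ResolutionOfSingularities-20148 --as helper` by res-L1-w45b-stub-3 g7. No `sorry`; standard axioms; no definitions.

WHY. At the ROOT `(X₀, I)` of a `DirLift.Ruled` datum (…NatTowerRuledDefs, clause (R3)) the tree holds quasi-regular 2-FRAMES of `I` at every
point of `supp I` but no dimension datum on `X₀` (no `Ch X₀`, so T-DIM is unavailable there); res-D-pv-051's route-C entry `T-DIRLIFT-UP` and
res-D-brk-4's `isRegularImmersionOfCodim_two_of_twoFrames` (p566652) want the CODIMENSION clause `hcodim`. This file closes the circle:
frames ⇒ codim (the converse of T-CENTRE-2FRAME (i) p564791).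

WHAT (namespace `…Cruxes.EquisingularLiftNat.Sections`).
* **`codim_two_of_isQuasiRegular_pair`** — `R` regular local, `J = (c₀, c₁) ⊆ 𝔪` with `(c₀, c₁)` quasi-regular and `R ⧸ J` regular ⇒
  `dim R⧸J + 2 = dim R`. Proof: Matsumura 14.2 selects from `{c₀, c₁}` an independent-differential generating family of `J` with
  `dim R⧸J + n = dim R`, `n ≤ 2`; `n ≤ 1` would make `J = (g)` principal, and then the linear form `a₁X₀ − a₀X₁` (`cᵢ = aᵢ g`) kills `c`, so
  quasi-regularity puts `a₀, a₁ ∈ J ⊆ 𝔪` while `u₀a₀ + u₁a₁ = 1` — impossible in a local ring (and `J = 0` is excluded by the form `X₀`).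
* **`forall_codim_two_of_twoFrames`** — scheme form: `V(𝒞)` regular, `𝒪_{X,x}` regular and a quasi-regular 2-frame of `𝒞_x` at every `x ∈ supp 𝒞`
  ⇒ `∀ x ∈ supp 𝒞, dim (𝒪_{X,x} ⧸ 𝒞_x) + 2 = dim 𝒪_{X,x}` (`hcodim` verbatim); pointwise version `codim_two_of_twoFrame`.

References: [cite: Matsumura1987, Thm. 14.2, §16 Definition p. 124]. Tree: Literature `exists_span_eq_of_isRegularLocalRing_quotient`,
`RegularParameters.isRegularLocalRing_quotient_span_range`, `isQuasiRegular_def`; this seat's …NatCentreTwoFrame / …NatCentreCodimTwo.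
-/

set_option linter.dupNamespace false -- mandated namespace `Summit.<Summit>.<Problem>` of this single-conjunct summit

noncomputable section

open CategoryTheory AlgebraicGeometry IsLocalRing MvPolynomial
open Literature.AlgebraicGeometry.Resolution
open AlgebraicGeometry.Scheme.IdealSheafData

namespace Summit.ResolutionOfSingularities.ResolutionOfSingularities.Cruxes.EquisingularLiftNat.Sections

universe u

/-- A quasi-regular pair in a nontrivial ring does not generate the zero ideal (the form `X₀` would have to lie in `0·R[X]`).
[cite: Matsumura1987, §16 Definition p. 124] -/
theorem span_ne_bot_of_isQuasiRegular_pair {R : Type u} [CommRing R] [Nontrivial R] (c : Fin 2 → R) (hc : IsQuasiRegular c) :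
    Ideal.span (Set.range c) ≠ ⊥ := by
  intro hbot
  have hc0 : c 0 = 0 := by
    have : c 0 ∈ Ideal.span (Set.range c) := Ideal.subset_span ⟨0, rfl⟩
    rw [hbot] at this
    exact this
  have h := (isQuasiRegular_def c).mp hc 1 (X 0) (isHomogeneous_X R 0)
    (by rw [eval_X, hc0]; exact Ideal.zero_mem _) (Finsupp.single 0 1)
  rw [coeff_X, if_pos rfl, hbot, Ideal.mem_bot] at h
  exact one_ne_zero h

/-- A quasi-regular pair in a local domain does not generate a principal ideal: if `(c₀, c₁) = (g)` then writing `cᵢ = aᵢ g` and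
`g = u₀c₀ + u₁c₁`, one `aᵢ` is a unit, but the linear form `a₁X₀ − a₀X₁` kills `c`, so quasi-regularity forces `a₀, a₁ ∈ (c₀, c₁) ⊆ 𝔪`.
[cite: Matsumura1987, §16 Definition p. 124] -/
theorem span_ne_span_singleton_of_isQuasiRegular_pair {R : Type u} [CommRing R] [IsDomain R] [IsLocalRing R] (c : Fin 2 → R)
    (hc : IsQuasiRegular c) (hcm : Ideal.span (Set.range c) ≤ maximalIdeal R) (g : R) :
    Ideal.span (Set.range c) ≠ Ideal.span {g} := by
  intro hg
  by_cases hg0 : g = 0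
  · exact span_ne_bot_of_isQuasiRegular_pair c hc (by rw [hg, hg0, Ideal.span_singleton_eq_bot])
  -- `cᵢ = aᵢ g`, `g = Σ uᵢ cᵢ`
  have hci : ∀ i, ∃ a : R, a * g = c i := fun i =>
    Ideal.mem_span_singleton'.mp (hg ▸ Ideal.subset_span ⟨i, rfl⟩)
  choose a ha using hci
  obtain ⟨u, hu⟩ := Ideal.mem_span_range_iff_exists_fun.mp
    (show g ∈ Ideal.span (Set.range c) by rw [hg]; exact Ideal.mem_span_singleton_self g)
  have hsum : (∑ i, u i * a i) * g = g := by
    rw [Finset.sum_mul]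
    conv_rhs => rw [← hu]
    refine Finset.sum_congr rfl fun i _ => ?_
    rw [mul_assoc, ha i]
  have hone : ∑ i, u i * a i = 1 := by
    have h : (∑ i, u i * a i - 1) * g = 0 := by rw [sub_mul, hsum, one_mul, sub_self]
    exact sub_eq_zero.mp ((mul_eq_zero.mp h).resolve_right hg0)
  rw [Fin.sum_univ_two] at hone
  -- the linear form `a₁ X₀ - a₀ X₁` kills `c`
  set F : MvPolynomial (Fin 2) R := C (a 1) * X 0 - C (a 0) * X 1 with hF
  have hFh : F.IsHomogeneous 1 := by
    have h0 : (C (a 1) * X 0 : MvPolynomial (Fin 2) R).IsHomogeneous 1 := by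
      simpa using (isHomogeneous_C (Fin 2) (a 1)).mul (isHomogeneous_X R (0 : Fin 2))
    have h1 : (C (a 0) * X 1 : MvPolynomial (Fin 2) R).IsHomogeneous 1 := by
      simpa using (isHomogeneous_C (Fin 2) (a 0)).mul (isHomogeneous_X R (1 : Fin 2))
    exact h0.sub h1
  have hFev : eval c F ∈ Ideal.span (Set.range c) ^ (1 + 1) := by
    have : eval c F = 0 := by
      simp only [hF, map_sub, map_mul, eval_C, eval_X]
      rw [← ha 0, ← ha 1]; ring
    rw [this]; exact Ideal.zero_mem _
  have hcoef := (isQuasiRegular_def c).mp hc 1 F hFh hFev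
  have ha1 : a 1 ∈ Ideal.span (Set.range c) := by
    have h := hcoef (Finsupp.single 0 1)
    simp only [hF, coeff_sub, coeff_C_mul, coeff_X, Finsupp.single_left_inj (one_ne_zero), if_true] at h
    simpa using h
  have ha0 : a 0 ∈ Ideal.span (Set.range c) := by
    have h := hcoef (Finsupp.single 1 1)
    simp only [hF, coeff_sub, coeff_C_mul, coeff_X, Finsupp.single_left_inj (one_ne_zero), if_true] at h
    simpa using h
  -- but `u₀ a₀ + u₁ a₁ = 1` with `a₀, a₁ ∈ 𝔪`
  have hm : u 0 * a 0 + u 1 * a 1 ∈ maximalIdeal R :=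
    Ideal.add_mem _ (Ideal.mul_mem_left _ _ (hcm ha0)) (Ideal.mul_mem_left _ _ (hcm ha1))
  rw [hone] at hm
  exact (maximalIdeal.isMaximal R).ne_top (Ideal.eq_top_of_isUnit_mem _ hm isUnit_one)

/-- **A quasi-regular generating pair of a regular quotient has codimension `2`.** For `R` regular local, `J = (c₀, c₁) ⊆ 𝔪` with `(c₀, c₁)`
quasi-regular and `R ⧸ J` regular: `dim R⧸J + 2 = dim R` — the converse of `isQuasiRegular_of_span_pair_eq_of_codim_two`.
[cite: Matsumura1987, Thm. 14.2, §16 Definition p. 124] [OURS · L1 W4.5b]; NOT a statement of the manuscript. -/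
theorem codim_two_of_isQuasiRegular_pair {R : Type u} [CommRing R] [IsRegularLocalRing R] {J : Ideal R} (hJ : J ≤ maximalIdeal R)
    [IsRegularLocalRing (R ⧸ J)] (c : Fin 2 → R) (hc : IsQuasiRegular c) (hcJ : Ideal.span (Set.range c) = J) :
    ringKrullDim (R ⧸ J) + 2 = ringKrullDim R := by
  classical
  haveI : IsDomain R := isDomain_of_isRegularLocalRing R
  obtain ⟨n, f, hfG, hspan, hli⟩ := exists_span_eq_of_isRegularLocalRing_quotient hJ (Set.range c) hcJ
  have hf𝔪 : ∀ i, f i ∈ maximalIdeal R := fun i => hJ (hspan ▸ Ideal.subset_span ⟨i, rfl⟩)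
  have hdim := (RegularParameters.isRegularLocalRing_quotient_span_range f hf𝔪
    (forall_mem_maximalIdeal_of_linearIndependent_toCotangent f hf𝔪 hli)).2
  rw [hspan] at hdim
  -- `n ≤ 2`: `f` is injective with values among `c 0, c 1`
  have hfinj : Function.Injective f := by
    intro i j hij
    by_contra hne
    exact hne (hli.injective (by
      show (maximalIdeal R).toCotangent ⟨f i, hf𝔪 i⟩ = (maximalIdeal R).toCotangent ⟨f j, hf𝔪 j⟩
      congr 1
      exact Subtype.ext hij))
  choose a ha using fun i => hfG i
  have hainj : Function.Injective a := fun i j hij => hfinj (by rw [← ha i, ← ha j, hij])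
  have hn2 : n ≤ 2 := by simpa using Fintype.card_le_of_injective a hainj
  -- `n ≥ 2`: otherwise `J` is principal
  have hn : n = 2 := by
    by_contra hne
    have hprinc : ∃ g : R, J = Ideal.span {g} := by
      rcases Nat.lt_or_ge n 1 with h0 | h1
      · have hn0 : n = 0 := by omega
        subst hn0
        refine ⟨0, ?_⟩
        rw [← hspan, Ideal.span_singleton_eq_bot.mpr rfl, Set.range_eq_empty, Ideal.span_empty]
      · have hn1 : n = 1 := by omega
        subst hn1
        refine ⟨f 0, ?_⟩
        rw [← hspan]
        congr 1
        ext r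
        simp only [Set.mem_range, Set.mem_singleton_iff]
        exact ⟨fun ⟨i, hi⟩ => by rw [← hi, Subsingleton.elim i 0], fun h => ⟨0, h.symm⟩⟩
    obtain ⟨g, hg⟩ := hprinc
    exact span_ne_span_singleton_of_isQuasiRegular_pair c hc (hcJ.symm ▸ hJ) g (hcJ.trans hg)
  subst hn
  exact hdim

/-- **Scheme form, at a point: a quasi-regular 2-frame gives codimension `2`.** For `𝒞` with `V(𝒞)` regular and a point `s` of `V(𝒞)` with
`𝒪_{X,ι s}` regular: a quasi-regular pair generating `𝒞_{ι s}` forces `dim (𝒪_{X,ι s} ⧸ 𝒞_{ι s}) + 2 = dim 𝒪_{X,ι s}`.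
[cite: Matsumura1987, Thm. 14.2] [OURS · L1 W4.5b]; NOT a statement of the manuscript. -/
theorem codim_two_of_twoFrame {X : Scheme.{u}} (𝒞 : X.IdealSheafData) (h𝒞 : Scheme.IsRegular 𝒞.subscheme)
    (s : 𝒞.subscheme) [IsRegularLocalRing (X.presheaf.stalk (𝒞.subschemeι s))]
    (c : Fin 2 → X.presheaf.stalk (𝒞.subschemeι s)) (hc : IsQuasiRegular c)
    (hcJ : Ideal.span (Set.range c) = stalkIdeal 𝒞 (𝒞.subschemeι s)) :
    ringKrullDim (X.presheaf.stalk (𝒞.subschemeι s) ⧸ stalkIdeal 𝒞 (𝒞.subschemeι s)) + 2 =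
      ringKrullDim (X.presheaf.stalk (𝒞.subschemeι s)) := by
  have hsurj : Function.Surjective (𝒞.subschemeι.stalkMap s).hom := 𝒞.subschemeι.stalkMap_surjective s
  have hker : RingHom.ker (𝒞.subschemeι.stalkMap s).hom = stalkIdeal 𝒞 (𝒞.subschemeι s) := by
    rw [← stalkIdeal_ker_eq_ker_stalkMap, Scheme.IdealSheafData.ker_subschemeι]
  haveI := h𝒞 s
  haveI : IsRegularLocalRing (X.presheaf.stalk (𝒞.subschemeι s) ⧸ stalkIdeal 𝒞 (𝒞.subschemeι s)) :=
    IsRegularLocalRing.of_ringEquiv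
      (((RingHom.quotientKerEquivOfSurjective hsurj).symm).trans (Ideal.quotEquivOfEq hker))
  have hx : 𝒞.subschemeι s ∈ (𝒞.support : Set X) := by
    rw [← Scheme.IdealSheafData.range_subschemeι]; exact ⟨s, rfl⟩
  exact codim_two_of_isQuasiRegular_pair ((mem_support_iff_stalkIdeal_le 𝒞 _).mp hx) c hc hcJ

/-- **Frames ⇒ `hcodim`** (the converse of T-CENTRE-2FRAME (i)): for `X` regular at the points of `supp 𝒞`, `V(𝒞)` regular, and a quasi-regular
2-frame of `𝒞` at every point of `supp 𝒞` (`DirLift.Ruled` (R3), `TCPlus.MemberKC`-born centres, …): `dim (𝒪_{X,x} ⧸ 𝒞_x) + 2 = dim 𝒪_{X,x}`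
on `supp 𝒞` — the `hcodim` input of res-D-brk-4's `isRegularImmersionOfCodim_two_of_twoFrames` (p566652), verbatim.
[cite: Matsumura1987, Thm. 14.2] [OURS · L1 W4.5b] toward `stub_elnat_coneTowerPointResolution` (stmt-ResolutionOfSingularities-20148); NOT a
statement of the manuscript. -/
theorem forall_codim_two_of_twoFrames {X : Scheme.{u}} (hX : Scheme.IsRegular X) (𝒞 : X.IdealSheafData)
    (h𝒞 : Scheme.IsRegular 𝒞.subscheme)
    (hCframe : ∀ x ∈ 𝒞.support, ∃ c : Fin 2 → X.presheaf.stalk x, Ideal.span (Set.range c) = stalkIdeal 𝒞 x ∧ IsQuasiRegular c) :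
    ∀ x ∈ 𝒞.support, ringKrullDim (X.presheaf.stalk x ⧸ stalkIdeal 𝒞 x) + 2 = ringKrullDim (X.presheaf.stalk x) := by
  intro x hx
  have hx' : x ∈ Set.range 𝒞.subschemeι := by rw [Scheme.IdealSheafData.range_subschemeι]; exact hx
  obtain ⟨s, rfl⟩ := hx'
  obtain ⟨c, hcJ, hc⟩ := hCframe _ hx
  haveI := hX (𝒞.subschemeι s)
  exact codim_two_of_twoFrame 𝒞 h𝒞 s c hc hcJ

end Summit.ResolutionOfSingularities.ResolutionOfSingularities.Cruxes.EquisingularLiftNat.Sections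

end
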